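import Literature.Geometry.Kaehler.NearlyHolomorphicCycleSupport
import Literature.AlgebraicGeometry.HodgeTheory.KodairaSerreSectionsAllDim
import Mathlib.Analysis.Convex.PathConnected
import HarnessLib

/-!
# Route `HolomorphicityRate`, crux `RateGap`: a holomorphic cycle support of codimension `p`

Stub `stub_existsHolomorphicCycleSupport` (G, pure complex geometry) of the reshaped line
`registered` of crux `RateGap` (`stmt-HodgeConjecture-10762`,
`Summit.HodgeConjecture.HodgeConjecture.Theses.HolomorphicityRate.RateGap`): for `X` smooth
projective of dimension `n` over `ℂ`, `0 < p ≤ n`, every Hodge model `A` (`X^an`), every Riemannian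
metric `g` on the real tangent bundle of `X^an` and every `t`, there is a set `S ⊆ X^an` which is a
nearly holomorphic cycle support of codimension `p` and defect `≤ t` with EMPTY bad set
(`Literature.Geometry.Kaehler.IsNearlyHolomorphicCycleSupport g p t S ∅`): `S` is closed, connected,
and near each of its points the regular zero set of `p` holomorphic functions.

## The argument

* `isRegularPointOfCodim_connectedComponentIn_locus` (general complex manifolds): for regular
  local equations `R` of codimension `k` (`Literature.Geometry.Kaehler.RegularEquations`: opens
  `O_a`, holomorphic `F_a : O_a → ℂᵏ` with consistent zero sets and onto differentials along
  `Z = {F = 0}`), every point `x` of a connected component `S` of `Z` (taken inside `Z`,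
  `connectedComponentIn`) is a regular point of codimension `k` OF `S`: a holomorphic straightening
  `e : M ⇀ ℂᵏ × ℂᵈ` with `(e ·).1 = F_a` (`RegularEquations.exists_straightening`, the holomorphic
  implicit function theorem, Griffiths–Harris Ch. 0 §2) sends `Z` near `x` onto the slice
  `{v.1 = 0}` of a ball, a convex hence connected set, so `Z ∩ U ⊆ S` on the chart neighbourhood
  `U = e⁻¹(ball)`, and `S ∩ U = U ∩ F_a⁻¹(0)`.
* `exists_isNearlyHolomorphicCycleSupport_of_regularEquations`: hence a connected component of a
  non-empty regular zero locus is, for every metric and every `t`, a nearly holomorphic cycle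
  support of codimension `k` with empty bad set (closed: components of closed sets are closed;
  regular points of complex codimension `k` have `J`-stable tangent planes,
  `IsRegularPointOfCodim.isNearlyHolomorphicRegularPoint`).
* `stub_existsHolomorphicCycleSupport`: on the Hodge model `A` of a smooth projective `n`-fold,
  `n ≥ 1`, the tree's transverse flag of `n` hyperplane sections read on `X^an`
  (`Literature.AlgebraicGeometry.HodgeTheory.exists_transverse_flag`, Bertini `n` times + GAGA §2 n°6)
  gives a regular flag (`KodairaSerreFlag.FlagSections.flag`) whose level `p`
  (`RegularFlag.eqns p`) is a system of regular equations of codimension `p` with non-empty locus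
  (it contains the non-empty deepest level, `FlagSections.locus_top_nonempty`, `RegularFlag.locus_anti`).

## References

* P. Griffiths, J. Harris, *Principles of Algebraic Geometry* (1978), Ch. 0 §2.
* J.-P. Serre, *Géométrie algébrique et géométrie analytique* (1956), §2 n°6, n° 16 Lemme 8.
* D. McDuff, D. Salamon, *Introduction to Symplectic Topology* (3rd ed., 2017), Thm. 7.4.1.
-/

noncomputable section

open scoped Manifold ContDiff Topology
open Set Filter

-- `Summit.HodgeConjecture.HodgeConjecture.Theorems` is the mandated namespace (single-conjunct summit:
-- Sub = Summit), which `linter.dupNamespace` flags on every declaration; the lakefile turns the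
-- linter off tree-wide (weak option), restated here so stand-alone elaboration is warning-free too.
set_option linter.dupNamespace false

namespace Summit.HodgeConjecture.HodgeConjecture.Theorems

open Literature.AlgebraicGeometry.HodgeTheory Literature.AlgebraicGeometry.Motives
  Literature.Geometry.Kaehler

section General

variable {E : Type*} [NormedAddCommGroup E] [NormedSpace ℂ E]
  {M : Type*} [TopologicalSpace M] [ChartedSpace E M]
  {α : Type*} {k d : ℕ}

/-- **A connected component of a closed set (taken inside the set) is closed**: it is
preconnected with closure inside the closed set, hence contains its closure. [folklore] -/
theorem isClosed_connectedComponentIn_of_isClosed {F : Set M} (hF : IsClosed F) (x : M) :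
    IsClosed (connectedComponentIn F x) := by
  by_cases hx : x ∈ F
  · refine isClosed_of_closure_subset ?_
    exact isPreconnected_connectedComponentIn.closure.subset_connectedComponentIn
      (subset_closure (mem_connectedComponentIn hx))
      ((closure_mono (connectedComponentIn_subset F x)).trans hF.closure_subset)
  · rw [connectedComponentIn_eq_empty hx]
    exact isClosed_empty

/-- **The slice `{v.1 = 0}` of a ball of `ℂᵏ × ℂᵈ` is preconnected**: it is convex over `ℝ`
(intersection of a ball with a real-linear subspace). [folklore] -/
theorem isPreconnected_ball_inter_fst_eq_zero (c : (Fin k → ℂ) × (Fin d → ℂ)) (r : ℝ) :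
    IsPreconnected (Metric.ball c r ∩ {v : (Fin k → ℂ) × (Fin d → ℂ) | v.1 = 0}) := by
  refine Convex.isPreconnected ((convex_ball c r).inter ?_)
  intro v hv w hw a b _ _ _
  simp only [mem_setOf_eq] at hv hw ⊢
  rw [Prod.fst_add, Prod.smul_fst, Prod.smul_fst, hv, hw, smul_zero, smul_zero, add_zero]

variable [FiniteDimensional ℂ E] [IsManifold 𝓘(ℂ, E) ω M]

/-- **Connected components of a regular zero locus are complex submanifolds of codimension `k`.**
Let `R` be regular local equations of codimension `k` on the complex manifold `M`
(`dim E = k + d`), `Z = {F = 0}` their locus and `S` the connected component in `Z` of a point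
`x₀`. Then every `x ∈ S` is a regular point of codimension `k` of `S`: on a chart neighbourhood
`U ∋ x` one has `S ∩ U = U ∩ F_a⁻¹(0)` with `F_a` holomorphic on `U` and `d(F_a)_x` onto. Indeed a
holomorphic straightening `e : M ⇀ ℂᵏ × ℂᵈ` of `F_a` at `x` (`(e ·).1 = F_a`, holomorphic implicit
function theorem) identifies `Z ∩ e⁻¹(B)`, `B` a small ball at `e x`, with the convex slice
`B ∩ {v.1 = 0}`, a connected subset of `Z` through `x`, hence inside the component `S`.
[cite: GriffithsHarris1978, Ch. 0 §2 pp. 18–20] -/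
theorem isRegularPointOfCodim_connectedComponentIn_locus (R : RegularEquations E M α k)
    (hd : Module.finrank ℂ E = k + d) {x₀ x : M} (hx : x ∈ connectedComponentIn R.locus x₀) :
    IsRegularPointOfCodim 𝓘(ℂ, E) (connectedComponentIn R.locus x₀) k x := by
  -- `x` lies on the locus: a chart index `a` with `F_a x = 0`, and a straightening `e` of `F_a` at `x`
  obtain ⟨a, ha, hxa⟩ := connectedComponentIn_subset _ _ hx
  obtain ⟨e, hxe, hsub, -, -, hfst⟩ := R.exists_straightening hd ha hxa
  -- a ball `B` around `e x` inside the target, and the chart neighbourhood `U = e.source ∩ e⁻¹(B)`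
  obtain ⟨r, hr, hball⟩ := Metric.isOpen_iff.1 e.open_target (e x) (e.map_source hxe)
  obtain ⟨U, hUo, hxU, hUsrc, hUball⟩ : ∃ U : Set M, IsOpen U ∧ x ∈ U ∧ U ⊆ e.source ∧
      ∀ y ∈ U, e y ∈ Metric.ball (e x) r :=
    ⟨e.source ∩ e ⁻¹' Metric.ball (e x) r, e.isOpen_inter_preimage Metric.isOpen_ball,
      ⟨hxe, Metric.mem_ball_self hr⟩, fun y hy => hy.1, fun y hy => hy.2⟩
  -- the straightened slice `s = e.symm (B ∩ {v.1 = 0})`: a preconnected subset of `Z` through `x`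
  have hs_pre : IsPreconnected (e.symm '' (Metric.ball (e x) r ∩ {v | v.1 = 0})) :=
    (isPreconnected_ball_inter_fst_eq_zero (e x) r).image _
      (e.continuousOn_symm.mono fun v hv => hball hv.1)
  have hs_sub : e.symm '' (Metric.ball (e x) r ∩ {v | v.1 = 0}) ⊆ R.locus := by
    rintro _ ⟨v, ⟨hv, hv0⟩, rfl⟩
    have hvt : v ∈ e.target := hball hv
    have hvs : e.symm v ∈ e.source := e.map_target hvt
    refine (R.mem_locus_iff (hsub hvs)).2 ?_
    rw [← hfst _ hvs, e.right_inv hvt]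
    exact hv0
  have hmem_s : ∀ y ∈ U, R.F a y = 0 → y ∈ e.symm '' (Metric.ball (e x) r ∩ {v | v.1 = 0}) := by
    intro y hyU hy0
    refine ⟨e y, ⟨hUball y hyU, ?_⟩, e.left_inv (hUsrc hyU)⟩
    show (e y).1 = 0
    rw [hfst y (hUsrc hyU), hy0]
  -- the slice lies in the component of `x`, which is the component of `x₀`
  have hsS : e.symm '' (Metric.ball (e x) r ∩ {v | v.1 = 0}) ⊆ connectedComponentIn R.locus x₀ := by
    rw [connectedComponentIn_eq hx]
    exact hs_pre.subset_connectedComponentIn (hmem_s x hxU hxa) hs_sub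
  refine ⟨U, hUo, hxU, R.F a, (R.mdifferentiableOn_F a).mono fun y hy => hsub (hUsrc hy), ?_,
    R.surjective_mfderiv a x ha hxa⟩
  ext y
  constructor
  · rintro ⟨hyS, hyU⟩
    exact ⟨hyU, (R.mem_locus_iff (hsub (hUsrc hyU))).1 (connectedComponentIn_subset _ _ hyS)⟩
  · rintro ⟨hyU, hy0⟩
    exact ⟨hsS (hmem_s y hyU hy0), hyU⟩

variable [IsManifold 𝓘(ℝ, E) ∞ M]

/-- **A non-empty regular zero locus contains a nearly holomorphic cycle support of codimension
`k` with empty bad set**, for every Riemannian metric `g` on the real tangent bundle and every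
defect bound `t`: the connected component `S` (inside `Z = {F = 0}`) of any point of `Z` is closed
(components of the closed set `Z` are closed), connected, and each of its points is a regular
point of complex codimension `k` of `S` (`isRegularPointOfCodim_connectedComponentIn_locus`),
hence a nearly holomorphic regular point of defect `0 ≤ |t|` — the real differential of the
holomorphic equations is `ℂ`-linear, so the tangent planes are `J`-stable
(`IsRegularPointOfCodim.isNearlyHolomorphicRegularPoint`). The model case `Sg = ∅` of
`IsNearlyHolomorphicCycleSupport` (McDuff–Salamon Thm. 7.4.1, here with genuinely holomorphic
equations). [cite: GriffithsHarris1978, Ch. 0 §2 pp. 18–20] -/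
theorem exists_isNearlyHolomorphicCycleSupport_of_regularEquations (R : RegularEquations E M α k)
    (hd : Module.finrank ℂ E = k + d) (hne : R.locus.Nonempty)
    (g : Bundle.RiemannianMetric (fun x : M => TangentSpace 𝓘(ℝ, E) x)) (t : ℝ) :
    ∃ S : Set M, IsNearlyHolomorphicCycleSupport g k t S ∅ := by
  obtain ⟨x₀, hx₀⟩ := hne
  refine ⟨connectedComponentIn R.locus x₀, isNearlyHolomorphicCycleSupport_empty_iff.2
    ⟨isClosed_connectedComponentIn_of_isClosed R.isClosed_locus x₀,
      isConnected_connectedComponentIn_iff.2 hx₀, fun x hx => ?_⟩⟩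
  exact (isRegularPointOfCodim_connectedComponentIn_locus R hd hx).isNearlyHolomorphicRegularPoint g t

end General

/-- **Stub G — `existsHolomorphicCycleSupport` (pure complex geometry).** For `X` smooth projective
of dimension `n`, `0 < p ≤ n`, every Hodge model `A` (`X^an`), every Riemannian metric `g` on the real
tangent bundle of `X^an` and every `t`, there is a closed `S ⊆ X^an` which is a nearly holomorphic
cycle support of codimension `p` and defect `≤ t` with EMPTY bad set: `S` closed and connected, and
near each of its points the regular zero set of `p` holomorphic functions (so the tangent planes are
complex subspaces, defect `0 ≤ |t|`). Witness: a connected component of the codimension-`p` level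
`{u₀ = ⋯ = u_{p-1} = 0}` of the transverse flag of hyperplane sections of `X ↪ ℙᴺ` read on `X^an`
(`Literature.AlgebraicGeometry.HodgeTheory.exists_transverse_flag`, Bertini + GAGA §2 n°6), a system
of regular equations of codimension `p` (`RegularFlag.eqns`) with non-empty locus (it contains the
non-empty deepest level), via `exists_isNearlyHolomorphicCycleSupport_of_regularEquations`.
[cite: SerreGAGA1956, §2 n°6 Cor. 2 and n° 16 Lemme 8] -/
theorem stub_existsHolomorphicCycleSupport : ∀ (n p : ℕ) (X : Literature.AlgebraicGeometry.Motives.SchemeOver ℂ), Literature.AlgebraicGeometry.Motives.IsSmoothProjective n X → p ≤ n → 0 < p → ∀ (A : Literature.AlgebraicGeometry.HodgeTheory.HodgeModel n X) (g : Bundle.RiemannianMetric (fun x : A.carrier => TangentSpace 𝓘(ℝ, A.model) x)) (t : ℝ), ∃ S : Set A.carrier, Literature.Geometry.Kaehler.IsNearlyHolomorphicCycleSupport g p t S ∅ := by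
  intro n p X hX hpn hp0 A g t
  haveI : AlgebraicGeometry.IsIntegral X.left := IsSmoothProjective.isIntegral_holds hX
  have hn : 0 < n := lt_of_lt_of_le hp0 hpn
  have hφ : Literature.NumberTheory.Transcendental.IsAnalytification A.model X n A.toComplexPoints :=
    A.isAnalytification
  -- the transverse flag of `n` hyperplane sections on `X^an`, as a regular flag
  obtain ⟨H, s, hs, -, hflag, -, hZne, -⟩ := exists_transverse_flag hX hn hφ
  let F : KodairaSerreFlag.FlagSections A.model A.toComplexPoints H n := ⟨s, hs, hflag, hZne⟩
  -- its level `p`: regular equations of codimension `p` with non-empty locus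
  have hne : ((F.flag hφ).eqns p hpn).locus.Nonempty :=
    (F.locus_top_nonempty hφ).mono ((F.flag hφ).locus_anti hpn le_rfl)
  have hd : Module.finrank ℂ A.model = p + (n - p) := by
    rw [hφ.finrank_eq]
    omega
  exact exists_isNearlyHolomorphicCycleSupport_of_regularEquations ((F.flag hφ).eqns p hpn) hd hne g t

end Summit.HodgeConjecture.HodgeConjecture.Theorems
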